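import Literature.NumberTheory.Automorphic.UnitaryGroupTruncatedKernelClassBorelCountTwo
import Literature.NumberTheory.Automorphic.UnitaryGroupSubgroupCosetSumUnfoldingFin
import Literature.NumberTheory.Automorphic.UnitaryGroupHyperbolicJKernelUnfolding
import HarnessLib

/-!
# Unfolding Arthur's `j`-kernel of a regular hyperbolic class of `U(J₂)` over `G_γ(F)\G(𝔸_F)`:
# `∫_{G(F)\G(𝔸)} Σ_{δ ∈ G_γ(F)\G(F)} f(x⁻¹δ⁻¹γδx)·u_T(δx) dx = c_μ ∫_{G(𝔸)} β(g) f(g⁻¹γg) u_T(g) dν_G(g)` (rank one,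
# `H`-side copy)
(Rogawski, *Automorphic Representations of Unitary Groups in Three Variables* (1990), §6.1 pp. 79–80,
(6.1.1)–(6.1.3): «`J^T_𝔬(f)` can be expressed as a weighted orbital integral»; §7.3 pp. 97–98 (the same terms for
`H = U(2) × U(1)`); Arthur, *A trace formula for reductive groups I*, Duke Math. J. 45 (1978), §8: the unramified
classes `𝔬` unfold over `G_γ(ℚ)\G(𝔸)`; Gelbart (1975), §9.B (9.40)–(9.45) for the unfolding of a coset sum)

Topic `NumberTheory/Automorphic`; namespace `Literature.NumberTheory.Automorphic.UnitaryGroup`. THEOREMS ONLY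
over accepted tree modules: no definition, no named fact, no instance, no notation, no `sorry`. Item (σ-h-4) of the
`H`-side copy of LAWS 1–5 (census `CENSUS-LAWS-Hside` §3 LAW 5 (σ-h)) of the T1-qs road of
`Cruxes/H413/Lines/F0_T1InnerFormTraceIdentity.lean` (cell `pub/hodgecm-mathlib`, crux H413): the `N = 2` twin of
★ `UnitaryGroupHyperbolicJKernelUnfolding` (W2-c) §§1, 2(b), 3, 4, token-parallel; its rank-free §2(a)
`tsum_fiber_eq_tsum_quotient_centralizer` (pure group theory) is IMPORTED from the ★ file, and the coset-sum unfolding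
is the all-rank ★ `UnitaryGroupSubgroupCosetSumUnfoldingFin`. Letters of ★ `UnitaryGroupTruncatedKernelClassBorelCountTwo`
(`truncatedKernelClass_eq_tsum_mul_weight_sub_sum_of_hyperbolic_two`) VERBATIM: quadratic `E/F` with involution `c`,
`c² = 1`; the regular hyperbolic torus point `γ♯ = ι(g₀)`, `hg₀ : g₀ = d(a, (c a)⁻¹)`, `c a · a ≠ 1`; the Weyl element
`w♯ = ι(w)`, `hw : w = J₂`; a conjugation-invariant class map `cl` whose class `𝔬 = cl⁻¹{i}` contains `γ♯` and a
section `sec` with `(sec γ′)⁻¹ γ♯ (sec γ′) = γ′`; Arthur's weight `u_T(y) = 1 − [T < H(y)] − [T < H(w♯ y)]` INLINE.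
The rational centraliser is `G_γ(F) := Subgroup.centralizer {γ♯} ≤ G(F)` (`= T(F)`, inside `B(F)` by ★
`mem_arithmeticBorel_of_commute_hyperbolic_two`).

* §1 **`centralizer_le_arithmeticBorel_of_hyperbolic_two`** (`G_γ(F) ≤ B(F)`), `borelHeight_mul_eq_of_mem_centralizer_two`,
  `borelHeight_weyl_mul_mul_eq_of_mem_centralizer_two`, **`jWeight_mul_eq_of_mem_centralizer_two`** — THE WEIGHT `u_T`
  IS LEFT-`G_γ(F)`-INVARIANT.
* §2 **`tsum_fiber_jKernel_eq_tsum_quotient_two`** — `Σ'_{γ′ ∈ 𝔬} f(x⁻¹γ′x)·u_T(sec γ′ · x) = Σ'_{q ∈ G_γ(F)\G(F)} ψ_T(q̃ x)`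
  with `ψ_T(y) = f(y⁻¹γ♯y)·u_T(y)`, its `[0, ∞]` twin **`tsum_fiber_jKernel_enorm_eq_tsum_quotient_two`**, and
  **`quotFun_jKernel_eq_tsum_quotient_two`** (the descended `j`-kernel IS the coset sum).
* §3 **`lintegral_jKernel_enorm_eq_unfoldingConstant_mul_lintegral_two`** — `[0, ∞]` unfolding against any covering
  weight `β` of `G_γ(F)♯`, constant `c_μ = unfoldingConstant G(F) count μ ν_G`.
* §4 **`integrable_quotFun_jKernel_and_integral_eq_mul_integral_two`** — the Bochner unfolding under
  `hfin : ∫⁻ β(g)‖f(g⁻¹γ♯g)·u_T(g)‖ₑ dν_G < ∞` (the `T(𝔸)`-fibre step of the sequel discharges it).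

## References

* J. D. Rogawski, *Automorphic Representations of Unitary Groups in Three Variables*, Ann. of Math. Stud. 123
  (1990), §2.2 (p. 13), §6.1 (pp. 79–80), §7.3 (pp. 97–98) [Rogawski1990].
* J. Arthur, *A trace formula for reductive groups I: terms associated to classes in `G(ℚ)`*, Duke Math. J. 45
  (1978), §8 [Arthur1978TraceFormulaI].
* S. Gelbart, *Automorphic forms on adele groups*, Ann. of Math. Stud. 83 (1975), §9.B (9.40)–(9.45) [Gelbart1975].
-/

set_option autoImplicit false

noncomputable section

open MeasureTheory Measure NumberField IsDedekindDomain Set Matrix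
open Literature.MeasureTheory.Group
open scoped NNReal ENNReal MatrixGroups

namespace Literature.NumberTheory.Automorphic

namespace UnitaryGroup

variable {F E : Type} [Field F] [NumberField F] [Field E] [NumberField E] [Algebra F E]
  {c : E ≃ₐ[F] E}

/-! ## §1 The rational centraliser of a regular hyperbolic element fixes Arthur's weight -/

section Weight

/-- **`G_γ(F) ≤ B(F)`** for the regular hyperbolic `γ♯ = ι(d(a, (ca)⁻¹))`: an element of `G(F)` commuting with
`γ♯` is diagonal, hence upper triangular (★ `mem_arithmeticBorel_of_commute_hyperbolic_two`; Rogawski §3.6: the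
centraliser of a regular element of `M` is `M`). [cite: Rogawski1990, §3.6 (pp. 28–29) and §6.1 (p. 79)] -/
theorem centralizer_le_arithmeticBorel_of_hyperbolic_two {a : Eˣ} (ha : c (a : E) * (a : E) ≠ 1)
    {g₀ w : (quasiSplit F E c 2).Rational}
    (hg₀ : ((g₀.1 : GL (Fin 2) E) : Matrix (Fin 2) (Fin 2) E) = !![(a : E), 0; 0, (c (a : E))⁻¹])
    (hw : ((w.1 : GL (Fin 2) E) : Matrix (Fin 2) (Fin 2) E) = !![(0 : E), 1; 1, 0]) :
    Subgroup.centralizer {(⟨(quasiSplit F E c 2).toAdelic g₀, g₀, rfl⟩ : (quasiSplit F E c 2).arithmeticSubgroup)} ≤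
      arithmeticBorel F E c 2 := fun _ hδ =>
  (mem_arithmeticBorel_of_commute_hyperbolic_two ha hg₀ hw (Subgroup.mem_centralizer_singleton_iff.1 hδ)).1

/-- `H(δ y) = H(y)` for `δ ∈ G_γ(F)` (`δ ∈ B(F)` by §1 and `B(F)` fixes the Borel height ★
`borelHeight_arithmeticBorel_mul_two`). [cite: Rogawski1990, §6.1 (pp. 79–80)] -/
theorem borelHeight_mul_eq_of_mem_centralizer_two {a : Eˣ} (ha : c (a : E) * (a : E) ≠ 1)
    {g₀ w : (quasiSplit F E c 2).Rational}
    (hg₀ : ((g₀.1 : GL (Fin 2) E) : Matrix (Fin 2) (Fin 2) E) = !![(a : E), 0; 0, (c (a : E))⁻¹])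
    (hw : ((w.1 : GL (Fin 2) E) : Matrix (Fin 2) (Fin 2) E) = !![(0 : E), 1; 1, 0])
    {δ : (quasiSplit F E c 2).arithmeticSubgroup}
    (hδ : δ ∈ Subgroup.centralizer
      {(⟨(quasiSplit F E c 2).toAdelic g₀, g₀, rfl⟩ : (quasiSplit F E c 2).arithmeticSubgroup)})
    (y : (quasiSplit F E c 2).Adelic) :
    borelHeight ((δ : (quasiSplit F E c 2).Adelic) * y) = borelHeight y :=
  borelHeight_arithmeticBorel_mul_two (centralizer_le_arithmeticBorel_of_hyperbolic_two ha hg₀ hw hδ) y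

/-- `H(w♯ δ y) = H(w♯ y)` for `δ ∈ G_γ(F)`: `w♯ δ w♯⁻¹ ∈ B(F)` (★ `mem_arithmeticBorel_of_commute_hyperbolic_two`, second
conjunct: `w` normalises the diagonal torus) and `w♯ δ y = (w♯ δ w♯⁻¹)(w♯ y)`. [cite: Rogawski1990, §6.1 (pp. 79–80)] -/
theorem borelHeight_weyl_mul_mul_eq_of_mem_centralizer_two {a : Eˣ} (ha : c (a : E) * (a : E) ≠ 1)
    {g₀ w : (quasiSplit F E c 2).Rational}
    (hg₀ : ((g₀.1 : GL (Fin 2) E) : Matrix (Fin 2) (Fin 2) E) = !![(a : E), 0; 0, (c (a : E))⁻¹])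
    (hw : ((w.1 : GL (Fin 2) E) : Matrix (Fin 2) (Fin 2) E) = !![(0 : E), 1; 1, 0])
    {δ : (quasiSplit F E c 2).arithmeticSubgroup}
    (hδ : δ ∈ Subgroup.centralizer
      {(⟨(quasiSplit F E c 2).toAdelic g₀, g₀, rfl⟩ : (quasiSplit F E c 2).arithmeticSubgroup)})
    (y : (quasiSplit F E c 2).Adelic) :
    borelHeight ((quasiSplit F E c 2).toAdelic w * ((δ : (quasiSplit F E c 2).Adelic) * y)) =
      borelHeight ((quasiSplit F E c 2).toAdelic w * y) := by
  have h2 := (mem_arithmeticBorel_of_commute_hyperbolic_two ha hg₀ hw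
    (Subgroup.mem_centralizer_singleton_iff.1 hδ)).2
  have e : (quasiSplit F E c 2).toAdelic w * ((δ : (quasiSplit F E c 2).Adelic) * y) =
      (((⟨(quasiSplit F E c 2).toAdelic w, w, rfl⟩ * δ * (⟨(quasiSplit F E c 2).toAdelic w, w, rfl⟩)⁻¹ :
        (quasiSplit F E c 2).arithmeticSubgroup)) : (quasiSplit F E c 2).Adelic) *
        ((quasiSplit F E c 2).toAdelic w * y) := by
    rw [Subgroup.coe_mul, Subgroup.coe_mul, Subgroup.coe_inv]
    change _ = (quasiSplit F E c 2).toAdelic w * (δ : (quasiSplit F E c 2).Adelic) *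
      ((quasiSplit F E c 2).toAdelic w)⁻¹ * ((quasiSplit F E c 2).toAdelic w * y)
    group
  rw [e, borelHeight_arithmeticBorel_mul_two h2]

/-- **ARTHUR'S WEIGHT IS LEFT-`G_γ(F)`-INVARIANT**: for `δ ∈ G_γ(F)` and every `T`, `y`,
`1 − [T < H(δy)] − [T < H(w♯δy)] = 1 − [T < H(y)] − [T < H(w♯y)]` (the `ite` spelling of ★ p822003's `j`-kernel) —
the token that makes `f(y⁻¹γ♯y)·u_T(y)` descend to `G_γ(F)\G(𝔸)` [Rogawski §6.1: the weight is a function on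
`M\G`]. [cite: Rogawski1990, §6.1 (6.1.1)] [cite: Arthur1978TraceFormulaI, §8] -/
theorem jWeight_mul_eq_of_mem_centralizer_two {a : Eˣ} (ha : c (a : E) * (a : E) ≠ 1)
    {g₀ w : (quasiSplit F E c 2).Rational}
    (hg₀ : ((g₀.1 : GL (Fin 2) E) : Matrix (Fin 2) (Fin 2) E) = !![(a : E), 0; 0, (c (a : E))⁻¹])
    (hw : ((w.1 : GL (Fin 2) E) : Matrix (Fin 2) (Fin 2) E) = !![(0 : E), 1; 1, 0])
    {δ : (quasiSplit F E c 2).arithmeticSubgroup}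
    (hδ : δ ∈ Subgroup.centralizer
      {(⟨(quasiSplit F E c 2).toAdelic g₀, g₀, rfl⟩ : (quasiSplit F E c 2).arithmeticSubgroup)})
    (T : ℝ≥0) (y : (quasiSplit F E c 2).Adelic) :
    ((1 : ℂ) - (if T < borelHeight ((δ : (quasiSplit F E c 2).Adelic) * y) then (1 : ℂ) else 0) -
        (if T < borelHeight ((quasiSplit F E c 2).toAdelic w * ((δ : (quasiSplit F E c 2).Adelic) * y))
          then (1 : ℂ) else 0)) =
      ((1 : ℂ) - (if T < borelHeight y then (1 : ℂ) else 0) -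
        (if T < borelHeight ((quasiSplit F E c 2).toAdelic w * y) then (1 : ℂ) else 0)) := by
  rw [borelHeight_mul_eq_of_mem_centralizer_two ha hg₀ hw hδ y,
    borelHeight_weyl_mul_mul_eq_of_mem_centralizer_two ha hg₀ hw hδ y]

end Weight

/-! ## §2 (continued) The `j`-kernel of `U(J₂)` as a coset sum over `G_γ(F)\G(F)` -/

section JKernel

/-- **THE `j`-KERNEL AS A COSET SUM OVER `G_γ(F)\G(F)`**: with `ψ_T(y) := f(y⁻¹γ♯y)·(1 − [T<H(y)] − [T<H(w♯y)])`,
`Σ'_{γ′ ∈ 𝔬} f(x⁻¹γ′x)·(1 − [T<H(sec γ′ · x)] − [T<H(w♯ · sec γ′ · x)]) = Σ'_{q ∈ G_γ(F)\G(F)} ψ_T(q̃ x)` — the left-hand side is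
★ p822003's `j`-kernel (first summand of `truncatedKernelClass_eq_tsum_mul_weight_sub_sum_of_hyperbolic_two`), the right-hand
side the coset sum unfolded by ★ `UnitaryGroupSubgroupCosetSumUnfolding` at `Λ := G_γ(F)` [Rogawski (6.1.1):
`Σ_{δ ∈ M\G} f(x⁻¹δ⁻¹γδx)(…)`]. [cite: Rogawski1990, §6.1 (6.1.1)] [cite: Arthur1978TraceFormulaI, §8] -/
theorem tsum_fiber_jKernel_eq_tsum_quotient_two {a : Eˣ} (ha : c (a : E) * (a : E) ≠ 1)
    {g₀ w : (quasiSplit F E c 2).Rational}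
    (hg₀ : ((g₀.1 : GL (Fin 2) E) : Matrix (Fin 2) (Fin 2) E) = !![(a : E), 0; 0, (c (a : E))⁻¹])
    (hw : ((w.1 : GL (Fin 2) E) : Matrix (Fin 2) (Fin 2) E) = !![(0 : E), 1; 1, 0])
    {ι : Type*} {cl : (quasiSplit F E c 2).arithmeticSubgroup → ι} (hcl : IsConjInvariant cl) {i : ι}
    (hi : cl ⟨(quasiSplit F E c 2).toAdelic g₀, g₀, rfl⟩ = i)
    (sec : cl ⁻¹' {i} → (quasiSplit F E c 2).arithmeticSubgroup)
    (hsec : ∀ γ : cl ⁻¹' {i},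
      (sec γ)⁻¹ * ⟨(quasiSplit F E c 2).toAdelic g₀, g₀, rfl⟩ * sec γ = (γ : (quasiSplit F E c 2).arithmeticSubgroup))
    (f : (quasiSplit F E c 2).Adelic → ℂ) (T : ℝ≥0) (x : (quasiSplit F E c 2).Adelic) :
    (∑' γ : cl ⁻¹' {i},
        f (x⁻¹ * ((γ : (quasiSplit F E c 2).arithmeticSubgroup) : (quasiSplit F E c 2).Adelic) * x) *
          (1 - (if T < borelHeight (((sec γ : (quasiSplit F E c 2).arithmeticSubgroup) : (quasiSplit F E c 2).Adelic) * x)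
                  then (1 : ℂ) else 0) -
               (if T < borelHeight ((((⟨(quasiSplit F E c 2).toAdelic w, w, rfl⟩ * sec γ :
                  (quasiSplit F E c 2).arithmeticSubgroup)) : (quasiSplit F E c 2).Adelic) * x) then (1 : ℂ) else 0))) =
      ∑' q : Quotient (QuotientGroup.rightRel (Subgroup.centralizer
          {(⟨(quasiSplit F E c 2).toAdelic g₀, g₀, rfl⟩ : (quasiSplit F E c 2).arithmeticSubgroup)})),
        f (((((q.out : (quasiSplit F E c 2).arithmeticSubgroup)) : (quasiSplit F E c 2).Adelic) * x)⁻¹ *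
            (quasiSplit F E c 2).toAdelic g₀ *
            ((((q.out : (quasiSplit F E c 2).arithmeticSubgroup)) : (quasiSplit F E c 2).Adelic) * x)) *
          ((1 : ℂ) - (if T < borelHeight ((((q.out : (quasiSplit F E c 2).arithmeticSubgroup)) :
                (quasiSplit F E c 2).Adelic) * x) then (1 : ℂ) else 0) -
            (if T < borelHeight ((quasiSplit F E c 2).toAdelic w *
                ((((q.out : (quasiSplit F E c 2).arithmeticSubgroup)) : (quasiSplit F E c 2).Adelic) * x))
              then (1 : ℂ) else 0)) := by
  -- the summand as a function of (conjugate, conjugator)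
  set Φ : (quasiSplit F E c 2).arithmeticSubgroup → (quasiSplit F E c 2).arithmeticSubgroup → ℂ := fun γ δ =>
    f (x⁻¹ * ((γ : (quasiSplit F E c 2).arithmeticSubgroup) : (quasiSplit F E c 2).Adelic) * x) *
      (1 - (if T < borelHeight (((δ : (quasiSplit F E c 2).arithmeticSubgroup) : (quasiSplit F E c 2).Adelic) * x)
              then (1 : ℂ) else 0) -
           (if T < borelHeight ((((⟨(quasiSplit F E c 2).toAdelic w, w, rfl⟩ * δ :
              (quasiSplit F E c 2).arithmeticSubgroup)) : (quasiSplit F E c 2).Adelic) * x) then (1 : ℂ) else 0))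
    with hΦ
  have hwδ : ∀ δ : (quasiSplit F E c 2).arithmeticSubgroup,
      ((((⟨(quasiSplit F E c 2).toAdelic w, w, rfl⟩ * δ : (quasiSplit F E c 2).arithmeticSubgroup)) :
        (quasiSplit F E c 2).Adelic) * x) =
        (quasiSplit F E c 2).toAdelic w * (((δ : (quasiSplit F E c 2).arithmeticSubgroup) :
          (quasiSplit F E c 2).Adelic) * x) := fun δ => by
    rw [Subgroup.coe_mul, mul_assoc]
  have hΦinv : ∀ (δ : (quasiSplit F E c 2).arithmeticSubgroup), ∀ l ∈ Subgroup.centralizer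
      {(⟨(quasiSplit F E c 2).toAdelic g₀, g₀, rfl⟩ : (quasiSplit F E c 2).arithmeticSubgroup)},
      Φ (δ⁻¹ * ⟨(quasiSplit F E c 2).toAdelic g₀, g₀, rfl⟩ * δ) (l * δ) =
        Φ (δ⁻¹ * ⟨(quasiSplit F E c 2).toAdelic g₀, g₀, rfl⟩ * δ) δ := by
    intro δ l hl
    simp only [hΦ]
    rw [hwδ, hwδ]
    simp only [Subgroup.coe_mul, mul_assoc]
    rw [jWeight_mul_eq_of_mem_centralizer_two ha hg₀ hw hl T _]
  have key := tsum_fiber_eq_tsum_quotient_centralizer hcl hi sec hsec Φ hΦinv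
  simp only [hΦ] at key
  rw [key]
  refine tsum_congr fun q => ?_
  rw [hwδ]
  congr 2
  rw [Subgroup.coe_mul, Subgroup.coe_mul, Subgroup.coe_inv]
  change x⁻¹ * ((((q.out : (quasiSplit F E c 2).arithmeticSubgroup)) : (quasiSplit F E c 2).Adelic)⁻¹ *
      (quasiSplit F E c 2).toAdelic g₀ * (((q.out : (quasiSplit F E c 2).arithmeticSubgroup)) :
        (quasiSplit F E c 2).Adelic)) * x = _
  group

/-- **THE `[0, ∞]` MAJORANT OF THE `j`-KERNEL AS A COSET SUM**: the same re-indexing for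
`‖f(x⁻¹γ′x)‖ₑ · ‖1 − [T<H(sec γ′ x)] − [T<H(w♯ sec γ′ x)]‖ₑ` (the integrand whose quotient integral controls absolute
convergence). [cite: Rogawski1990, §6.1 (6.1.1)] [cite: Arthur1978TraceFormulaI, §8] -/
theorem tsum_fiber_jKernel_enorm_eq_tsum_quotient_two {a : Eˣ} (ha : c (a : E) * (a : E) ≠ 1)
    {g₀ w : (quasiSplit F E c 2).Rational}
    (hg₀ : ((g₀.1 : GL (Fin 2) E) : Matrix (Fin 2) (Fin 2) E) = !![(a : E), 0; 0, (c (a : E))⁻¹])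
    (hw : ((w.1 : GL (Fin 2) E) : Matrix (Fin 2) (Fin 2) E) = !![(0 : E), 1; 1, 0])
    {ι : Type*} {cl : (quasiSplit F E c 2).arithmeticSubgroup → ι} (hcl : IsConjInvariant cl) {i : ι}
    (hi : cl ⟨(quasiSplit F E c 2).toAdelic g₀, g₀, rfl⟩ = i)
    (sec : cl ⁻¹' {i} → (quasiSplit F E c 2).arithmeticSubgroup)
    (hsec : ∀ γ : cl ⁻¹' {i},
      (sec γ)⁻¹ * ⟨(quasiSplit F E c 2).toAdelic g₀, g₀, rfl⟩ * sec γ = (γ : (quasiSplit F E c 2).arithmeticSubgroup))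
    (f : (quasiSplit F E c 2).Adelic → ℂ) (T : ℝ≥0) (x : (quasiSplit F E c 2).Adelic) :
    (∑' γ : cl ⁻¹' {i},
        ‖f (x⁻¹ * ((γ : (quasiSplit F E c 2).arithmeticSubgroup) : (quasiSplit F E c 2).Adelic) * x)‖ₑ *
          ‖(1 - (if T < borelHeight (((sec γ : (quasiSplit F E c 2).arithmeticSubgroup) : (quasiSplit F E c 2).Adelic) * x)
                  then (1 : ℂ) else 0) -
               (if T < borelHeight ((((⟨(quasiSplit F E c 2).toAdelic w, w, rfl⟩ * sec γ :
                  (quasiSplit F E c 2).arithmeticSubgroup)) : (quasiSplit F E c 2).Adelic) * x) then (1 : ℂ) else 0))‖ₑ) =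
      ∑' q : Quotient (QuotientGroup.rightRel (Subgroup.centralizer
          {(⟨(quasiSplit F E c 2).toAdelic g₀, g₀, rfl⟩ : (quasiSplit F E c 2).arithmeticSubgroup)})),
        ‖f (((((q.out : (quasiSplit F E c 2).arithmeticSubgroup)) : (quasiSplit F E c 2).Adelic) * x)⁻¹ *
            (quasiSplit F E c 2).toAdelic g₀ *
            ((((q.out : (quasiSplit F E c 2).arithmeticSubgroup)) : (quasiSplit F E c 2).Adelic) * x))‖ₑ *
          ‖((1 : ℂ) - (if T < borelHeight ((((q.out : (quasiSplit F E c 2).arithmeticSubgroup)) :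
                (quasiSplit F E c 2).Adelic) * x) then (1 : ℂ) else 0) -
            (if T < borelHeight ((quasiSplit F E c 2).toAdelic w *
                ((((q.out : (quasiSplit F E c 2).arithmeticSubgroup)) : (quasiSplit F E c 2).Adelic) * x))
              then (1 : ℂ) else 0))‖ₑ := by
  set Φ : (quasiSplit F E c 2).arithmeticSubgroup → (quasiSplit F E c 2).arithmeticSubgroup → ℝ≥0∞ := fun γ δ =>
    ‖f (x⁻¹ * ((γ : (quasiSplit F E c 2).arithmeticSubgroup) : (quasiSplit F E c 2).Adelic) * x)‖ₑ *
      ‖(1 - (if T < borelHeight (((δ : (quasiSplit F E c 2).arithmeticSubgroup) : (quasiSplit F E c 2).Adelic) * x)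
              then (1 : ℂ) else 0) -
           (if T < borelHeight ((((⟨(quasiSplit F E c 2).toAdelic w, w, rfl⟩ * δ :
              (quasiSplit F E c 2).arithmeticSubgroup)) : (quasiSplit F E c 2).Adelic) * x) then (1 : ℂ) else 0))‖ₑ
    with hΦ
  have hwδ : ∀ δ : (quasiSplit F E c 2).arithmeticSubgroup,
      ((((⟨(quasiSplit F E c 2).toAdelic w, w, rfl⟩ * δ : (quasiSplit F E c 2).arithmeticSubgroup)) :
        (quasiSplit F E c 2).Adelic) * x) =
        (quasiSplit F E c 2).toAdelic w * (((δ : (quasiSplit F E c 2).arithmeticSubgroup) :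
          (quasiSplit F E c 2).Adelic) * x) := fun δ => by
    rw [Subgroup.coe_mul, mul_assoc]
  have hΦinv : ∀ (δ : (quasiSplit F E c 2).arithmeticSubgroup), ∀ l ∈ Subgroup.centralizer
      {(⟨(quasiSplit F E c 2).toAdelic g₀, g₀, rfl⟩ : (quasiSplit F E c 2).arithmeticSubgroup)},
      Φ (δ⁻¹ * ⟨(quasiSplit F E c 2).toAdelic g₀, g₀, rfl⟩ * δ) (l * δ) =
        Φ (δ⁻¹ * ⟨(quasiSplit F E c 2).toAdelic g₀, g₀, rfl⟩ * δ) δ := by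
    intro δ l hl
    simp only [hΦ]
    rw [hwδ, hwδ]
    simp only [Subgroup.coe_mul, mul_assoc]
    rw [jWeight_mul_eq_of_mem_centralizer_two ha hg₀ hw hl T _]
  have key := tsum_fiber_eq_tsum_quotient_centralizer hcl hi sec hsec Φ hΦinv
  simp only [hΦ] at key
  rw [key]
  refine tsum_congr fun q => ?_
  rw [hwδ]
  congr 3
  rw [Subgroup.coe_mul, Subgroup.coe_mul, Subgroup.coe_inv]
  change x⁻¹ * ((((q.out : (quasiSplit F E c 2).arithmeticSubgroup)) : (quasiSplit F E c 2).Adelic)⁻¹ *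
      (quasiSplit F E c 2).toAdelic g₀ * (((q.out : (quasiSplit F E c 2).arithmeticSubgroup)) :
        (quasiSplit F E c 2).Adelic)) * x = _
  group

/-- **THE DESCENDED `j`-KERNEL IS THE COSET SUM OF ★ FILE A**: on the automorphic quotient `X = G(𝔸_F) ⧸ G(F)` the
function `[g] ↦ J_T(g⁻¹)` (★ `AdelicGroupData.quotFun`, the dictionary of ★ `truncatedTraceClass_def`) attached to the
`j`-kernel `J_T(y) = Σ'_{γ′ ∈ 𝔬} f(y⁻¹γ′y)·u_T(sec γ′ · y)` equals `x ↦ Σ'_{q ∈ G_γ(F)\G(F)} ψ_T(q̃ · x̃⁻¹)`, the integrand of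
★ `lintegral_tsum_quotient_eq_unfoldingConstant_mul_lintegral_fin` ∕ ★ `integrable_tsum_quotient_and_integral_eq_mul_integral_of_subgroup_fin`
at `Λ := G_γ(F)`. [cite: Rogawski1990, §2.2 (p. 13) and §6.1 (6.1.1)] -/
theorem quotFun_jKernel_eq_tsum_quotient_two {a : Eˣ} (ha : c (a : E) * (a : E) ≠ 1)
    {g₀ w : (quasiSplit F E c 2).Rational}
    (hg₀ : ((g₀.1 : GL (Fin 2) E) : Matrix (Fin 2) (Fin 2) E) = !![(a : E), 0; 0, (c (a : E))⁻¹])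
    (hw : ((w.1 : GL (Fin 2) E) : Matrix (Fin 2) (Fin 2) E) = !![(0 : E), 1; 1, 0])
    {ι : Type*} {cl : (quasiSplit F E c 2).arithmeticSubgroup → ι} (hcl : IsConjInvariant cl) {i : ι}
    (hi : cl ⟨(quasiSplit F E c 2).toAdelic g₀, g₀, rfl⟩ = i)
    (sec : cl ⁻¹' {i} → (quasiSplit F E c 2).arithmeticSubgroup)
    (hsec : ∀ γ : cl ⁻¹' {i},
      (sec γ)⁻¹ * ⟨(quasiSplit F E c 2).toAdelic g₀, g₀, rfl⟩ * sec γ = (γ : (quasiSplit F E c 2).arithmeticSubgroup))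
    (f : (quasiSplit F E c 2).Adelic → ℂ) (T : ℝ≥0) (x : (quasiSplit F E c 2).automorphicQuotient) :
    (quasiSplit F E c 2).quotFun (fun y => ∑' γ : cl ⁻¹' {i},
        f (y⁻¹ * ((γ : (quasiSplit F E c 2).arithmeticSubgroup) : (quasiSplit F E c 2).Adelic) * y) *
          (1 - (if T < borelHeight (((sec γ : (quasiSplit F E c 2).arithmeticSubgroup) : (quasiSplit F E c 2).Adelic) * y)
                  then (1 : ℂ) else 0) -
               (if T < borelHeight ((((⟨(quasiSplit F E c 2).toAdelic w, w, rfl⟩ * sec γ :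
                  (quasiSplit F E c 2).arithmeticSubgroup)) : (quasiSplit F E c 2).Adelic) * y) then (1 : ℂ) else 0))) x =
      ∑' q : Quotient (QuotientGroup.rightRel (Subgroup.centralizer
          {(⟨(quasiSplit F E c 2).toAdelic g₀, g₀, rfl⟩ : (quasiSplit F E c 2).arithmeticSubgroup)})),
        f (((((q.out : (quasiSplit F E c 2).arithmeticSubgroup)) : (quasiSplit F E c 2).Adelic) *
              (Quotient.out x : (quasiSplit F E c 2).Adelic)⁻¹)⁻¹ *
            (quasiSplit F E c 2).toAdelic g₀ *
            ((((q.out : (quasiSplit F E c 2).arithmeticSubgroup)) : (quasiSplit F E c 2).Adelic) *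
              (Quotient.out x : (quasiSplit F E c 2).Adelic)⁻¹)) *
          ((1 : ℂ) - (if T < borelHeight ((((q.out : (quasiSplit F E c 2).arithmeticSubgroup)) :
                (quasiSplit F E c 2).Adelic) * (Quotient.out x : (quasiSplit F E c 2).Adelic)⁻¹) then (1 : ℂ) else 0) -
            (if T < borelHeight ((quasiSplit F E c 2).toAdelic w *
                ((((q.out : (quasiSplit F E c 2).arithmeticSubgroup)) : (quasiSplit F E c 2).Adelic) *
                  (Quotient.out x : (quasiSplit F E c 2).Adelic)⁻¹)) then (1 : ℂ) else 0)) :=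
  tsum_fiber_jKernel_eq_tsum_quotient_two ha hg₀ hw hcl hi sec hsec f T
    (Quotient.out x : (quasiSplit F E c 2).Adelic)⁻¹

end JKernel

/-! ## §3–§4 The unfolding over `G_γ(F)\G(𝔸_F)` -/

section Unfold

variable [MeasurableSpace (quasiSplit F E c 2).Adelic] [BorelSpace (quasiSplit F E c 2).Adelic]

/-- Measurability of the orbital integrand `g ↦ f(g⁻¹ γ g)` of a Borel `f` (plumbing). [folklore] -/
private theorem measurable_comp_conj_two {f : (quasiSplit F E c 2).Adelic → ℂ} (hfm : Measurable f)
    (γ : (quasiSplit F E c 2).Adelic) : Measurable fun g : (quasiSplit F E c 2).Adelic => f (g⁻¹ * γ * g) :=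
  hfm.comp (((continuous_id.inv.mul continuous_const).mul continuous_id).measurable)

/-- Measurability of Arthur's weight `g ↦ 1 − [T<H(g)] − [T<H(w♯g)]` (the Borel height is continuous ★
`continuous_borelHeight`; plumbing). [folklore] -/
private theorem measurable_jWeight_two (wA : (quasiSplit F E c 2).Adelic) (T : ℝ≥0) :
    Measurable fun g : (quasiSplit F E c 2).Adelic =>
      ((1 : ℂ) - (if T < borelHeight g then (1 : ℂ) else 0) - (if T < borelHeight (wA * g) then (1 : ℂ) else 0)) := by
  have h1 : Measurable fun g : (quasiSplit F E c 2).Adelic => (if T < borelHeight g then (1 : ℂ) else 0) :=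
    Measurable.ite (measurableSet_setOf_lt_borelHeight T) measurable_const measurable_const
  have h2 : Measurable fun g : (quasiSplit F E c 2).Adelic => (if T < borelHeight (wA * g) then (1 : ℂ) else 0) := by
    have hm : Measurable fun g : (quasiSplit F E c 2).Adelic => wA * g := (continuous_const.mul continuous_id).measurable
    exact Measurable.ite ((measurableSet_setOf_lt_borelHeight T).preimage hm) measurable_const measurable_const
  exact (measurable_const.sub h1).sub h2

/-- **`[0, ∞]` UNFOLDING OF THE `j`-KERNEL'S MAJORANT** (`[0, ∞]` first): for an automorphic measure `μ` on
`X = G(𝔸_F) ⧸ G(F)`, an inversion-invariant Haar measure `ν_G` of `G(𝔸_F)`, a Borel `f` and every covering weight `β` of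
`G_γ(F)♯ = G_γ(F) ≤ G(𝔸_F)`:
`∫⁻_X Σ'_{γ′ ∈ 𝔬} ‖f(x̃ γ′ x̃⁻¹)‖ₑ·‖u_T(sec γ′ · x̃⁻¹)‖ₑ dμ(x) = c_μ · ∫⁻_{G(𝔸)} β(g)·‖f(g⁻¹γ♯g)‖ₑ·‖u_T(g)‖ₑ dν_G(g)`,
`c_μ = unfoldingConstant G(F) count μ ν_G` — so the descended `j`-kernel is absolutely integrable iff the right-hand side
is finite (`c_μ ≠ 0`, ★ `unfoldingConstant_quotientSubgroup_count_ne_zero_fin`). §2 re-indexing + ★ FILE A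
`lintegral_tsum_quotient_eq_unfoldingConstant_mul_lintegral_fin` at `Λ := G_γ(F)`, the integrand `‖f(y⁻¹γ♯y)‖ₑ‖u_T(y)‖ₑ` being
left-`G_γ(F)`-invariant by §1. [cite: Rogawski1990, §6.1 (6.1.1)] [cite: Arthur1978TraceFormulaI, §8]
[cite: Gelbart1975, §9.B (9.40)–(9.45)] -/
theorem lintegral_jKernel_enorm_eq_unfoldingConstant_mul_lintegral_two {a : Eˣ}
    (ha : c (a : E) * (a : E) ≠ 1) {g₀ w : (quasiSplit F E c 2).Rational}
    (hg₀ : ((g₀.1 : GL (Fin 2) E) : Matrix (Fin 2) (Fin 2) E) = !![(a : E), 0; 0, (c (a : E))⁻¹])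
    (hw : ((w.1 : GL (Fin 2) E) : Matrix (Fin 2) (Fin 2) E) = !![(0 : E), 1; 1, 0])
    (μ : Measure (quasiSplit F E c 2).automorphicQuotient) [(quasiSplit F E c 2).IsAutomorphicMeasure μ]
    (νG : Measure (quasiSplit F E c 2).Adelic) [νG.IsHaarMeasure] [νG.IsInvInvariant]
    {ι : Type*} {cl : (quasiSplit F E c 2).arithmeticSubgroup → ι} (hcl : IsConjInvariant cl) {i : ι}
    (hi : cl ⟨(quasiSplit F E c 2).toAdelic g₀, g₀, rfl⟩ = i)
    (sec : cl ⁻¹' {i} → (quasiSplit F E c 2).arithmeticSubgroup)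
    (hsec : ∀ γ : cl ⁻¹' {i},
      (sec γ)⁻¹ * ⟨(quasiSplit F E c 2).toAdelic g₀, g₀, rfl⟩ * sec γ = (γ : (quasiSplit F E c 2).arithmeticSubgroup))
    {f : (quasiSplit F E c 2).Adelic → ℂ} (hfm : Measurable f) (T : ℝ≥0)
    {β : (quasiSplit F E c 2).Adelic → ℝ≥0∞}
    (hβ : IsCoveringWeight ((Subgroup.centralizer
      {(⟨(quasiSplit F E c 2).toAdelic g₀, g₀, rfl⟩ : (quasiSplit F E c 2).arithmeticSubgroup)}).map
        (quasiSplit F E c 2).arithmeticSubgroup.subtype) β) :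
    haveI := t2Space_adeleRing_of_numberField E
    haveI := locallyCompactSpace_adeleRing' E
    haveI := secondCountableTopology_adeleRing E
    haveI : T2Space (quasiSplit F E c 2).Adelic :=
      inferInstanceAs (T2Space (adelic F E c 2 ((StdForm.antidiagonal 2).over E)))
    haveI : LocallyCompactSpace (quasiSplit F E c 2).Adelic :=
      inferInstanceAs (LocallyCompactSpace (adelic F E c 2 ((StdForm.antidiagonal 2).over E)))
    haveI : SecondCountableTopology (quasiSplit F E c 2).Adelic :=
      inferInstanceAs (SecondCountableTopology (adelic F E c 2 ((StdForm.antidiagonal 2).over E)))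
    haveI : DiscreteTopology (quasiSplit F E c 2).quotientSubgroup := by
      rw [quotientSubgroup_quasiSplit]; exact isDiscreteRational_quasiSplit
    letI := AdelicGroupData.measurableSpaceQuotientForm (quasiSplit F E c 2)
    haveI := AdelicGroupData.borelSpaceQuotientForm (quasiSplit F E c 2)
    haveI := AdelicGroupData.smulInvariantMeasureQuotientForm (quasiSplit F E c 2) μ
    haveI := AdelicGroupData.isFiniteMeasureOnCompactsQuotientForm (quasiSplit F E c 2) μ
    ∫⁻ x, (∑' γ : cl ⁻¹' {i},
        ‖f (((Quotient.out x : (quasiSplit F E c 2).Adelic)⁻¹)⁻¹ *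
              ((γ : (quasiSplit F E c 2).arithmeticSubgroup) : (quasiSplit F E c 2).Adelic) *
              (Quotient.out x : (quasiSplit F E c 2).Adelic)⁻¹)‖ₑ *
          ‖(1 - (if T < borelHeight (((sec γ : (quasiSplit F E c 2).arithmeticSubgroup) : (quasiSplit F E c 2).Adelic) *
                  (Quotient.out x : (quasiSplit F E c 2).Adelic)⁻¹) then (1 : ℂ) else 0) -
               (if T < borelHeight ((((⟨(quasiSplit F E c 2).toAdelic w, w, rfl⟩ * sec γ :
                  (quasiSplit F E c 2).arithmeticSubgroup)) : (quasiSplit F E c 2).Adelic) *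
                  (Quotient.out x : (quasiSplit F E c 2).Adelic)⁻¹) then (1 : ℂ) else 0))‖ₑ) ∂μ =
      (unfoldingConstant (quasiSplit F E c 2).quotientSubgroup
          (count : Measure (quasiSplit F E c 2).quotientSubgroup) μ νG : ℝ≥0∞) *
        ∫⁻ g, β g * (‖f (g⁻¹ * (quasiSplit F E c 2).toAdelic g₀ * g)‖ₑ *
          ‖((1 : ℂ) - (if T < borelHeight g then (1 : ℂ) else 0) -
            (if T < borelHeight ((quasiSplit F E c 2).toAdelic w * g) then (1 : ℂ) else 0))‖ₑ) ∂νG := by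
  -- the left-`G_γ(F)`-invariant integrand on the group
  set ψ : (quasiSplit F E c 2).Adelic → ℝ≥0∞ := fun g =>
    ‖f (g⁻¹ * (quasiSplit F E c 2).toAdelic g₀ * g)‖ₑ *
      ‖((1 : ℂ) - (if T < borelHeight g then (1 : ℂ) else 0) -
        (if T < borelHeight ((quasiSplit F E c 2).toAdelic w * g) then (1 : ℂ) else 0))‖ₑ with hψ
  have hψm : Measurable ψ :=
    (measurable_comp_conj_two hfm _).enorm.mul (measurable_jWeight_two ((quasiSplit F E c 2).toAdelic w) T).enorm
  have hψinv : ∀ l ∈ Subgroup.centralizer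
      {(⟨(quasiSplit F E c 2).toAdelic g₀, g₀, rfl⟩ : (quasiSplit F E c 2).arithmeticSubgroup)},
      ∀ y : (quasiSplit F E c 2).Adelic, ψ ((l : (quasiSplit F E c 2).Adelic) * y) = ψ y := by
    intro l hl y
    simp only [hψ]
    have hcomm : (l : (quasiSplit F E c 2).Adelic) * (quasiSplit F E c 2).toAdelic g₀ =
        (quasiSplit F E c 2).toAdelic g₀ * (l : (quasiSplit F E c 2).Adelic) := by
      have h := Subgroup.mem_centralizer_singleton_iff.1 hl
      exact congrArg Subtype.val h
    have e0 : ((l : (quasiSplit F E c 2).Adelic))⁻¹ * (quasiSplit F E c 2).toAdelic g₀ *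
        (l : (quasiSplit F E c 2).Adelic) = (quasiSplit F E c 2).toAdelic g₀ := by
      rw [mul_assoc, ← hcomm, inv_mul_cancel_left]
    have e1 : ((l : (quasiSplit F E c 2).Adelic) * y)⁻¹ * (quasiSplit F E c 2).toAdelic g₀ *
        ((l : (quasiSplit F E c 2).Adelic) * y) = y⁻¹ * (quasiSplit F E c 2).toAdelic g₀ * y := by
      calc ((l : (quasiSplit F E c 2).Adelic) * y)⁻¹ * (quasiSplit F E c 2).toAdelic g₀ *
            ((l : (quasiSplit F E c 2).Adelic) * y)
          = y⁻¹ * (((l : (quasiSplit F E c 2).Adelic))⁻¹ * (quasiSplit F E c 2).toAdelic g₀ *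
              (l : (quasiSplit F E c 2).Adelic)) * y := by group
        _ = y⁻¹ * (quasiSplit F E c 2).toAdelic g₀ * y := by rw [e0]
    rw [e1, jWeight_mul_eq_of_mem_centralizer_two ha hg₀ hw hl T y]
  have key := lintegral_tsum_quotient_eq_unfoldingConstant_mul_lintegral_fin μ νG hβ hψm hψinv
  simp only [hψ] at key
  rw [← key]
  refine lintegral_congr fun x => ?_
  rw [tsum_fiber_jKernel_enorm_eq_tsum_quotient_two ha hg₀ hw hcl hi sec hsec f T]

/-- **THE BOCHNER UNFOLDING OF THE `j`-KERNEL** (Rogawski (6.1.1): `J^T_𝔬(f)` → the weighted orbital integral over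
`M\G`, before the `A_M`-integration). Setting as in §3; assume
`hfin : ∫⁻ β(g)·‖f(g⁻¹γ♯g)·u_T(g)‖ₑ dν_G(g) < ∞` (discharged by the `T(𝔸)`-fibre step of the sequel). Then the descended
`j`-kernel `quotFun J_T`, `J_T(y) = Σ'_{γ′ ∈ 𝔬} f(y⁻¹γ′y)·(1 − [T<H(sec γ′ y)] − [T<H(w♯ sec γ′ y)])` — the first summand of ★
`truncatedKernelClass_eq_tsum_mul_weight_sub_sum_of_hyperbolic_two` — is `μ`-integrable and
`∫_X quotFun J_T dμ = c_μ · ∫_{G(𝔸)} (β g).toReal • (f(g⁻¹γ♯g)·(1 − [T<H g] − [T<H(w♯g)])) dν_G(g)`,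
`c_μ = unfoldingConstant G(F) count μ ν_G` (★ LAW 4's constant). ★ FILE A
`integrable_tsum_quotient_and_integral_eq_mul_integral_of_subgroup_fin` at `Λ := G_γ(F)` + §2.
[cite: Rogawski1990, §6.1 (6.1.1)] [cite: Arthur1978TraceFormulaI, §8] [cite: Gelbart1975, §9.B (9.40)–(9.45)] -/
theorem integrable_quotFun_jKernel_and_integral_eq_mul_integral_two {a : Eˣ}
    (ha : c (a : E) * (a : E) ≠ 1) {g₀ w : (quasiSplit F E c 2).Rational}
    (hg₀ : ((g₀.1 : GL (Fin 2) E) : Matrix (Fin 2) (Fin 2) E) = !![(a : E), 0; 0, (c (a : E))⁻¹])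
    (hw : ((w.1 : GL (Fin 2) E) : Matrix (Fin 2) (Fin 2) E) = !![(0 : E), 1; 1, 0])
    (μ : Measure (quasiSplit F E c 2).automorphicQuotient) [(quasiSplit F E c 2).IsAutomorphicMeasure μ]
    (νG : Measure (quasiSplit F E c 2).Adelic) [νG.IsHaarMeasure] [νG.IsInvInvariant]
    {ι : Type*} {cl : (quasiSplit F E c 2).arithmeticSubgroup → ι} (hcl : IsConjInvariant cl) {i : ι}
    (hi : cl ⟨(quasiSplit F E c 2).toAdelic g₀, g₀, rfl⟩ = i)
    (sec : cl ⁻¹' {i} → (quasiSplit F E c 2).arithmeticSubgroup)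
    (hsec : ∀ γ : cl ⁻¹' {i},
      (sec γ)⁻¹ * ⟨(quasiSplit F E c 2).toAdelic g₀, g₀, rfl⟩ * sec γ = (γ : (quasiSplit F E c 2).arithmeticSubgroup))
    {f : (quasiSplit F E c 2).Adelic → ℂ} (hfm : Measurable f) (T : ℝ≥0)
    {β : (quasiSplit F E c 2).Adelic → ℝ≥0∞}
    (hβ : IsCoveringWeight ((Subgroup.centralizer
      {(⟨(quasiSplit F E c 2).toAdelic g₀, g₀, rfl⟩ : (quasiSplit F E c 2).arithmeticSubgroup)}).map
        (quasiSplit F E c 2).arithmeticSubgroup.subtype) β)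
    (hfin : ∫⁻ g, β g * ‖f (g⁻¹ * (quasiSplit F E c 2).toAdelic g₀ * g) *
        ((1 : ℂ) - (if T < borelHeight g then (1 : ℂ) else 0) -
          (if T < borelHeight ((quasiSplit F E c 2).toAdelic w * g) then (1 : ℂ) else 0))‖ₑ ∂νG < ∞) :
    haveI := t2Space_adeleRing_of_numberField E
    haveI := locallyCompactSpace_adeleRing' E
    haveI := secondCountableTopology_adeleRing E
    haveI : T2Space (quasiSplit F E c 2).Adelic :=
      inferInstanceAs (T2Space (adelic F E c 2 ((StdForm.antidiagonal 2).over E)))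
    haveI : LocallyCompactSpace (quasiSplit F E c 2).Adelic :=
      inferInstanceAs (LocallyCompactSpace (adelic F E c 2 ((StdForm.antidiagonal 2).over E)))
    haveI : SecondCountableTopology (quasiSplit F E c 2).Adelic :=
      inferInstanceAs (SecondCountableTopology (adelic F E c 2 ((StdForm.antidiagonal 2).over E)))
    haveI : DiscreteTopology (quasiSplit F E c 2).quotientSubgroup := by
      rw [quotientSubgroup_quasiSplit]; exact isDiscreteRational_quasiSplit
    letI := AdelicGroupData.measurableSpaceQuotientForm (quasiSplit F E c 2)
    haveI := AdelicGroupData.borelSpaceQuotientForm (quasiSplit F E c 2)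
    haveI := AdelicGroupData.smulInvariantMeasureQuotientForm (quasiSplit F E c 2) μ
    haveI := AdelicGroupData.isFiniteMeasureOnCompactsQuotientForm (quasiSplit F E c 2) μ
    Integrable ((quasiSplit F E c 2).quotFun (fun y => ∑' γ : cl ⁻¹' {i},
        f (y⁻¹ * ((γ : (quasiSplit F E c 2).arithmeticSubgroup) : (quasiSplit F E c 2).Adelic) * y) *
          (1 - (if T < borelHeight (((sec γ : (quasiSplit F E c 2).arithmeticSubgroup) : (quasiSplit F E c 2).Adelic) * y)
                  then (1 : ℂ) else 0) -
               (if T < borelHeight ((((⟨(quasiSplit F E c 2).toAdelic w, w, rfl⟩ * sec γ :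
                  (quasiSplit F E c 2).arithmeticSubgroup)) : (quasiSplit F E c 2).Adelic) * y) then (1 : ℂ) else 0)))) μ ∧
      ∫ x, (quasiSplit F E c 2).quotFun (fun y => ∑' γ : cl ⁻¹' {i},
        f (y⁻¹ * ((γ : (quasiSplit F E c 2).arithmeticSubgroup) : (quasiSplit F E c 2).Adelic) * y) *
          (1 - (if T < borelHeight (((sec γ : (quasiSplit F E c 2).arithmeticSubgroup) : (quasiSplit F E c 2).Adelic) * y)
                  then (1 : ℂ) else 0) -
               (if T < borelHeight ((((⟨(quasiSplit F E c 2).toAdelic w, w, rfl⟩ * sec γ :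
                  (quasiSplit F E c 2).arithmeticSubgroup)) : (quasiSplit F E c 2).Adelic) * y) then (1 : ℂ) else 0))) x ∂μ =
        ((unfoldingConstant (quasiSplit F E c 2).quotientSubgroup
            (count : Measure (quasiSplit F E c 2).quotientSubgroup) μ νG : ℝ) : ℂ) *
          ∫ g, (β g).toReal • (f (g⁻¹ * (quasiSplit F E c 2).toAdelic g₀ * g) *
            ((1 : ℂ) - (if T < borelHeight g then (1 : ℂ) else 0) -
              (if T < borelHeight ((quasiSplit F E c 2).toAdelic w * g) then (1 : ℂ) else 0))) ∂νG := by
  -- the left-`G_γ(F)`-invariant integrand on the group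
  set ψ : (quasiSplit F E c 2).Adelic → ℂ := fun g =>
    f (g⁻¹ * (quasiSplit F E c 2).toAdelic g₀ * g) *
      ((1 : ℂ) - (if T < borelHeight g then (1 : ℂ) else 0) -
        (if T < borelHeight ((quasiSplit F E c 2).toAdelic w * g) then (1 : ℂ) else 0)) with hψ
  have hψm : Measurable ψ :=
    (measurable_comp_conj_two hfm _).mul (measurable_jWeight_two ((quasiSplit F E c 2).toAdelic w) T)
  have hψinv : ∀ l ∈ Subgroup.centralizer
      {(⟨(quasiSplit F E c 2).toAdelic g₀, g₀, rfl⟩ : (quasiSplit F E c 2).arithmeticSubgroup)},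
      ∀ y : (quasiSplit F E c 2).Adelic, ψ ((l : (quasiSplit F E c 2).Adelic) * y) = ψ y := by
    intro l hl y
    simp only [hψ]
    have hcomm : (l : (quasiSplit F E c 2).Adelic) * (quasiSplit F E c 2).toAdelic g₀ =
        (quasiSplit F E c 2).toAdelic g₀ * (l : (quasiSplit F E c 2).Adelic) := by
      have h := Subgroup.mem_centralizer_singleton_iff.1 hl
      exact congrArg Subtype.val h
    have e0 : ((l : (quasiSplit F E c 2).Adelic))⁻¹ * (quasiSplit F E c 2).toAdelic g₀ *
        (l : (quasiSplit F E c 2).Adelic) = (quasiSplit F E c 2).toAdelic g₀ := by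
      rw [mul_assoc, ← hcomm, inv_mul_cancel_left]
    have e1 : ((l : (quasiSplit F E c 2).Adelic) * y)⁻¹ * (quasiSplit F E c 2).toAdelic g₀ *
        ((l : (quasiSplit F E c 2).Adelic) * y) = y⁻¹ * (quasiSplit F E c 2).toAdelic g₀ * y := by
      calc ((l : (quasiSplit F E c 2).Adelic) * y)⁻¹ * (quasiSplit F E c 2).toAdelic g₀ *
            ((l : (quasiSplit F E c 2).Adelic) * y)
          = y⁻¹ * (((l : (quasiSplit F E c 2).Adelic))⁻¹ * (quasiSplit F E c 2).toAdelic g₀ *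
              (l : (quasiSplit F E c 2).Adelic)) * y := by group
        _ = y⁻¹ * (quasiSplit F E c 2).toAdelic g₀ * y := by rw [e0]
    rw [e1, jWeight_mul_eq_of_mem_centralizer_two ha hg₀ hw hl T y]
  have hint : ∫⁻ g, β g * ‖ψ g‖ₑ ∂νG < ∞ := by simpa only [hψ] using hfin
  obtain ⟨h1, h2⟩ := integrable_tsum_quotient_and_integral_eq_mul_integral_of_subgroup_fin μ νG hβ hψm hψinv hint
  -- the descended `j`-kernel is that coset sum, pointwise
  have hpt : (quasiSplit F E c 2).quotFun (fun y => ∑' γ : cl ⁻¹' {i},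
        f (y⁻¹ * ((γ : (quasiSplit F E c 2).arithmeticSubgroup) : (quasiSplit F E c 2).Adelic) * y) *
          (1 - (if T < borelHeight (((sec γ : (quasiSplit F E c 2).arithmeticSubgroup) : (quasiSplit F E c 2).Adelic) * y)
                  then (1 : ℂ) else 0) -
               (if T < borelHeight ((((⟨(quasiSplit F E c 2).toAdelic w, w, rfl⟩ * sec γ :
                  (quasiSplit F E c 2).arithmeticSubgroup)) : (quasiSplit F E c 2).Adelic) * y) then (1 : ℂ) else 0))) =
      fun x => ∑' q : Quotient (QuotientGroup.rightRel (Subgroup.centralizer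
          {(⟨(quasiSplit F E c 2).toAdelic g₀, g₀, rfl⟩ : (quasiSplit F E c 2).arithmeticSubgroup)})),
        ψ ((((q.out : (quasiSplit F E c 2).arithmeticSubgroup)) : (quasiSplit F E c 2).Adelic) *
          (Quotient.out x : (quasiSplit F E c 2).Adelic)⁻¹) := by
    funext x
    rw [quotFun_jKernel_eq_tsum_quotient_two ha hg₀ hw hcl hi sec hsec f T x]
  rw [hpt]
  exact ⟨h1, h2⟩

end Unfold

end UnitaryGroup

end Literature.NumberTheory.Automorphic
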